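import Summits.CriticalPhenomena.PercolationContinuityZ3.Theorems.Transplant.SkelFrm1RootHoldsQCKT
import Summits.CriticalPhenomena.PercolationContinuityZ3.Theorems.Transplant.SkelFrmBChoiceBridge0
import Summits.CriticalPhenomena.PercolationContinuityZ3.Theorems.Transplant.SkelFrmBChoiceHopFoot
import Summits.CriticalPhenomena.PercolationContinuityZ3.Theorems.Transplant.SkelFrmBChoiceRootLanding2
import Summits.CriticalPhenomena.PercolationContinuityZ3.Theorems.Transplant.SkelFrmBChoiceRootDepthR
import Summits.CriticalPhenomena.PercolationContinuityZ3.Theorems.Transplant.SkelFrmBChoiceRootLen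
import Summits.CriticalPhenomena.PercolationContinuityZ3.Theorems.Transplant.SkelFrmBParamsSlotsST
import HarnessLib

/-!
# N2 (frames-only node `SamePDropOfSkeletonFrm₁`, OPEN), (R) column: **THE FIRST-AXIS ROOT LEG FROM THE (R) VALUE ROWS** —
# `NegB.rootLegAt_frmQ3KT_fst_of_le` (the T TEMPLATE of the (R) `_of_le` wrapper; its V twin `…QCKV…_of_le` at the choice function of record
# `choiceAtQ3V` is a token port once the V skeleton lands — lead g13: wrappers of record file at Q3V only; this file is the kernel-checked template)

Every (R)-OWNED binder of the skeleton `NegB.rootLegAt_frmQ3KT_fst` (SkelFrm1RootHoldsQCKT p362778) is discharged at the values of record: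
the corridor row set `HK := kgRows0_of … mk qx Wx` and run length `N := KS.kgNR …` (RootRun p364533: `hrowR`, `rootRun_floors`), the window
radius `Rπ := NegB.Rπ … (SUS ex mx) q` with `hRQ_RT/hRB_RT/hRQ'_RT/hRM_RT` (SlotsST), `fat_le_Rπ`, the kits' thresholds and the depth row through
`ex_le_Rπ` (SlotsS), the hop prism's planar reading `hkR_hop_prism` + floor `hfR_hop_fst` (HopFoot p361915), the landing `c₁* = t + (X1, Y1s)` on
the terminal's shear line with `hx_0s` / `hX₁_0` (RootLanding2 p365411 / RootLanding p361102; cross-link budget `prB0 + ℓB0 + 5R′0 + 2 ≤ W` from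
(R-47)(b)'s coupling `2f + 5R′0 + 3 ≤ g` via `sL ≥ M_L − 1 ≥ g − 1`), the depth numeral `D0s + 13·reach(N_R) ≤ D0s + Z + 13·sL ≤ Rπ`
(RootDepthR p365939 `reachR1_le`), the bridge of record `KS.B0` with `B0_ok_of_atQ3 / B0_lo_le_hi / R'0_le_B0_R' / B0_core1_le / core1Lo_0_l1 /
hhopB_0 / hclear₁_0_of_floor / bridge0Sets_of_atQ3 / hbridge0K_of_atQ3_δr` (Bridge0 p359866, ChoiceBridge0 p361076), the rim device `hR₁_US` at
`η ≤ δr 0 / 2` with `SRex_fat_le_Rπ_sub` (SlotsS), and the length row `hlen_R1` (RootLen p366001) with `bridgeFrame_N = 0`.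
WHAT STAYS A HYPOTHESIS (by owner): the slot floors at the evaluated slots — `gFloorKG ≤ g`, `40·K·R′0 ≤ g`, `2f + 5R′0 + 3 ≤ g` ((R-47)(b)),
`fxR0 ≤ f`, the four `ex`-floors (`r₀0 RL + 1`, `r₀0 RB0 + 1`, `Yb0 + 1`, `D0s + Z + 13·⌊sL⌋ + 1`), `Px0 ⊆ Pv` (stmt's parametric union ResidQV /
my ResidR); the residual window `(qx, Wx)` under the Len3 caps `qx ≤ 100·n_L`, `Wx ≤ 20·sL`, `KGRes3` and the depth numeral `Z ≥ 13·reach(kgNv0)`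
(instance: `qxQ4/WxQ4`, stmt's `kgRes3_Q4`, `ZD2`/`reach_le_ZD2`); `hRs5` (cells' radii vs the seed); and the four READING rows of the root's boxes
`hfoot₁` (bridge region), `hfoot₂` (corridor regions, for every landing vertex over `(X1, Y1s)`), `hlastf` (last core → arrival cube), `hDm` (planar
diameter of the cut world) — p3's `SkelFrmBChoiceRootReadX` (next file).
NON-VACUITY (lead g11 standing order): every discharged row is a theorem of the cited value files at the same tuple; the remaining hypotheses are
exactly the rows the thin instance feeds from stmt's union (`two_fT_le_gT`, `le_gxQ/le_fxQ/le_exQ/subset_PxQ`) and p3's reading file — no floor is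
assumed twice, no `K₀` cap, no rate, no LEVEL-0 hypothesis.
builds on p205010 (kernel theorem, internal audit signed; external expert review pending) — nothing in this file uses p205010; nothing here is a claim
about the open node `SamePDropOfSkeletonFrm₁`.
Lane `prim-bschramm`, seat `prim-bschramm-p3` (gen 18; N2 design owner, (R) column owner); helper file (`--supports stmt-CriticalPhenomena-4575 --as helper`).
[cite: KozmaNitzan2024, §4 p. 28 ((32) at the root), Lemma 12 (pp. 23–25)] [cite: MartineauTassion2017, §3.2 Lemma 3.5, §4.3 Lemma 4.2]
-/

noncomputable section

open MeasureTheory ProbabilityTheory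
open scoped ENNReal Classical

namespace Summit.CriticalPhenomena.PercolationContinuityZ3.Theorems

namespace Transplant

open Literature.Probability.Percolation Literature.Probability.LatticeModels SimpleGraph KNCells KNLevels ChainPlanar ChainPara
open Literature.Probability.Percolation.KozmaNitzan.Cells (oth sgOf)
open Literature.Barriers.CriticalPhenomena (graphBall graphBall_mono mem_graphBall_self)
open SkelConc (Consts)
open Skel (winGraph)
open SkelI (tanOff)
open Skelφ (rootFrame RootFootT TargetFootT pgSideHalfW kgSL kgZ₀ kgZ₁ kgM₁ kgM₂ kgWm₂ kgWp₂)
open ChainPlanar (ScheduleNP BridgePrm BridgeOK)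
open Skelφ.StepI (OutNS)

namespace PlanarSkeletonFrm

namespace NegB

open Neg

variable {κ : Consts} {V : Type} [DecidableEq V] [Countable V] {G : SimpleGraph V} [G.LocallyFinite] {Φ : PlanarSkeletonFrm G} {t : V} {p : unitInterval}
  {hC : Φ.CylSubcritical p} {gv fv : Neg.FSlot} {Pv : PSlot} {ex mx : GSlot} {cv : CSlot} {bv : BSlot} {O : OutNS V} {q : unitInterval}

set_option maxHeartbeats 3200000 in
/-- **THE FIRST-AXIS ROOT LEG AT THE (T) CHOICE FUNCTION OF RECORD FROM THE (R) VALUE ROWS** — the skeleton `rootLegAt_frmQ3KT_fst` with every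
(R)-owned binder discharged; residual = slot floors, window caps, depth numeral, `hRs5`, and the four reading rows (see the module docstring).
[cite: KozmaNitzan2024, §4 p. 28 ((32) at the root)] -/
theorem rootLegAt_frmQ3KT_fst_of_le (hAt : (choiceAtQ3T κ Φ t p Pv gv fv (SUS ex mx) cv bv hC).AtQNQ O q) (h1 : Φ.types = {t})
    (hp0 : 0 < (p : ℝ)) (hp1 : (p : ℝ) < 1) (mk qx Wx Z : ℕ)
    -- slot floors at the evaluated slots `g := gOf …`, `f := fOf …`, `ex`, `Pv`
    (hgK : gFloorKG κ Φ t p O.merged mk ≤ gOf κ Φ t p O gv) (hg2 : 40 * Neg.K κ * KS0.R'0 κ Φ t p O.merged mk ≤ gOf κ Φ t p O gv)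
    (hfg : 2 * fOf κ Φ t p O fv + 5 * KS0.R'0 κ Φ t p O.merged mk + 3 ≤ gOf κ Φ t p O gv)
    (hf : KS.fxR0 κ Φ t p O.merged mk ≤ fOf κ Φ t p O fv)
    (hexRL : KS0.r₀0 t O.merged mk (RL κ Φ t p O gv fv) + 1 ≤ ex κ Φ t p O.merged (gOf κ Φ t p O gv) (fOf κ Φ t p O fv))
    (hexRB : KS0.r₀0 t O.merged mk (KS.RB0 κ Φ t p O.merged mk) + 1 ≤ ex κ Φ t p O.merged (gOf κ Φ t p O gv) (fOf κ Φ t p O fv))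
    (hexYb : KS.Yb0 κ Φ t p O.merged mk (gOf κ Φ t p O gv) (fOf κ Φ t p O fv) + 1 ≤ ex κ Φ t p O.merged (gOf κ Φ t p O gv) (fOf κ Φ t p O fv))
    (hexZ : KS.D0s κ Φ t p O.merged mk (gOf κ Φ t p O gv) (fOf κ Φ t p O fv) (kgq κ Φ t p O.merged (gOf κ Φ t p O gv) (fOf κ Φ t p O fv) qx) + Z +
      13 * (kgSL (nL κ Φ t p O.merged (gOf κ Φ t p O gv) (fOf κ Φ t p O fv)) (ℓL κ Φ t p O.merged (gOf κ Φ t p O gv) (fOf κ Φ t p O fv)) (hL κ Φ t p O.merged (gOf κ Φ t p O gv) (fOf κ Φ t p O fv))).toNat + 1 ≤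
        ex κ Φ t p O.merged (gOf κ Φ t p O gv) (fOf κ Φ t p O fv))
    (hPx : (KS.Px0 mk κ Φ t p O.merged).1 ⊆ (Pv κ Φ t p O.merged).1)
    -- the residual window under the Len3 caps, and the depth numeral `Z` bounding (C)'s reach at this window
    (hqx : qx ≤ 100 * nL κ Φ t p O.merged (gOf κ Φ t p O gv) (fOf κ Φ t p O fv))
    (hWx : (Wx : ℤ) ≤ 20 * kgSL (nL κ Φ t p O.merged (gOf κ Φ t p O gv) (fOf κ Φ t p O fv)) (ℓL κ Φ t p O.merged (gOf κ Φ t p O gv) (fOf κ Φ t p O fv)) (hL κ Φ t p O.merged (gOf κ Φ t p O gv) (fOf κ Φ t p O fv)))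
    (hx3 : KGRes3 κ Φ t p O.merged (gOf κ Φ t p O gv) (fOf κ Φ t p O fv) qx Wx)
    (hZ : 13 * ((((kgNv0 κ Φ t p O.merged (gOf κ Φ t p O gv) (fOf κ Φ t p O fv) mk qx Wx : ℕ) : ℤ) + 1) * (nL κ Φ t p O.merged (gOf κ Φ t p O gv) (fOf κ Φ t p O fv) : ℤ) +
      kgZ₀ (nL κ Φ t p O.merged (gOf κ Φ t p O gv) (fOf κ Φ t p O fv)) (vL κ Φ t p O.merged (gOf κ Φ t p O gv) (fOf κ Φ t p O fv)) (kgR κ Φ t p O.merged mk) 0 (kgq κ Φ t p O.merged (gOf κ Φ t p O gv) (fOf κ Φ t p O fv) qx)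
        (kgNv0 κ Φ t p O.merged (gOf κ Φ t p O gv) (fOf κ Φ t p O fv) mk qx Wx)
        (kgM₁ (nL κ Φ t p O.merged (gOf κ Φ t p O gv) (fOf κ Φ t p O fv)) (ℓL κ Φ t p O.merged (gOf κ Φ t p O gv) (fOf κ Φ t p O fv)) (hL κ Φ t p O.merged (gOf κ Φ t p O gv) (fOf κ Φ t p O fv)) (kgR κ Φ t p O.merged mk) 0 (kgW κ Φ t p O.merged (gOf κ Φ t p O gv) (fOf κ Φ t p O fv) Wx)
          (kgNv0 κ Φ t p O.merged (gOf κ Φ t p O gv) (fOf κ Φ t p O fv) mk qx Wx))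
        (kgM₂ (nL κ Φ t p O.merged (gOf κ Φ t p O gv) (fOf κ Φ t p O fv)) (ℓL κ Φ t p O.merged (gOf κ Φ t p O gv) (fOf κ Φ t p O fv)) (hL κ Φ t p O.merged (gOf κ Φ t p O gv) (fOf κ Φ t p O fv)) (vL κ Φ t p O.merged (gOf κ Φ t p O gv) (fOf κ Φ t p O fv)) (kgR κ Φ t p O.merged mk) 0
          (kgq κ Φ t p O.merged (gOf κ Φ t p O gv) (fOf κ Φ t p O fv) qx) (kgW κ Φ t p O.merged (gOf κ Φ t p O gv) (fOf κ Φ t p O fv) Wx) (kgNv0 κ Φ t p O.merged (gOf κ Φ t p O gv) (fOf κ Φ t p O fv) mk qx Wx)) +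
      kgZ₁ (nL κ Φ t p O.merged (gOf κ Φ t p O gv) (fOf κ Φ t p O fv)) (ℓL κ Φ t p O.merged (gOf κ Φ t p O gv) (fOf κ Φ t p O fv)) (hL κ Φ t p O.merged (gOf κ Φ t p O gv) (fOf κ Φ t p O fv)) (kgR κ Φ t p O.merged mk) 0 (kgW κ Φ t p O.merged (gOf κ Φ t p O gv) (fOf κ Φ t p O fv) Wx)
        (kgNv0 κ Φ t p O.merged (gOf κ Φ t p O gv) (fOf κ Φ t p O fv) mk qx Wx)
        (kgM₁ (nL κ Φ t p O.merged (gOf κ Φ t p O gv) (fOf κ Φ t p O fv)) (ℓL κ Φ t p O.merged (gOf κ Φ t p O gv) (fOf κ Φ t p O fv)) (hL κ Φ t p O.merged (gOf κ Φ t p O gv) (fOf κ Φ t p O fv)) (kgR κ Φ t p O.merged mk) 0 (kgW κ Φ t p O.merged (gOf κ Φ t p O gv) (fOf κ Φ t p O fv) Wx)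
          (kgNv0 κ Φ t p O.merged (gOf κ Φ t p O gv) (fOf κ Φ t p O fv) mk qx Wx))
        (kgWm₂ (nL κ Φ t p O.merged (gOf κ Φ t p O gv) (fOf κ Φ t p O fv)) (ℓL κ Φ t p O.merged (gOf κ Φ t p O gv) (fOf κ Φ t p O fv)) (hL κ Φ t p O.merged (gOf κ Φ t p O gv) (fOf κ Φ t p O fv)) (kgR κ Φ t p O.merged mk) 0 (kgW κ Φ t p O.merged (gOf κ Φ t p O gv) (fOf κ Φ t p O fv) Wx)
          (kgNv0 κ Φ t p O.merged (gOf κ Φ t p O gv) (fOf κ Φ t p O fv) mk qx Wx))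
        (kgWp₂ (nL κ Φ t p O.merged (gOf κ Φ t p O gv) (fOf κ Φ t p O fv)) (ℓL κ Φ t p O.merged (gOf κ Φ t p O gv) (fOf κ Φ t p O fv)) (hL κ Φ t p O.merged (gOf κ Φ t p O gv) (fOf κ Φ t p O fv)) (kgR κ Φ t p O.merged mk) 0 (kgW κ Φ t p O.merged (gOf κ Φ t p O gv) (fOf κ Φ t p O fv) Wx)
          (kgNv0 κ Φ t p O.merged (gOf κ Φ t p O gv) (fOf κ Φ t p O fv) mk qx Wx))
        (kgM₂ (nL κ Φ t p O.merged (gOf κ Φ t p O gv) (fOf κ Φ t p O fv)) (ℓL κ Φ t p O.merged (gOf κ Φ t p O gv) (fOf κ Φ t p O fv)) (hL κ Φ t p O.merged (gOf κ Φ t p O gv) (fOf κ Φ t p O fv)) (vL κ Φ t p O.merged (gOf κ Φ t p O gv) (fOf κ Φ t p O fv)) (kgR κ Φ t p O.merged mk) 0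
          (kgq κ Φ t p O.merged (gOf κ Φ t p O gv) (fOf κ Φ t p O fv) qx) (kgW κ Φ t p O.merged (gOf κ Φ t p O gv) (fOf κ Φ t p O fv) Wx) (kgNv0 κ Φ t p O.merged (gOf κ Φ t p O gv) (fOf κ Φ t p O fv) mk qx Wx)))
      ≤ (Z : ℤ))
    -- the cells' radii against the seed (instance: `hRs5_TAT`-type lemma at the g-slot of record)
    (hRs5 : ∀ i, KS.Rs t O.merged mk + 1 ≤ 5 * ((fcellsA κ Φ t p O.merged (gOf κ Φ t p O gv) (fOf κ Φ t p O fv))).r i)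
    -- the four READING rows of the root's boxes (SkelFrmBChoiceRootReadX) — bridge region, corridor regions, last core, planar diameter of the cut world
    (hfoot₁ : ∀ w ∈ graphBall G t (Rπ κ Φ t p O.merged (gOf κ Φ t p O gv) (fOf κ Φ t p O fv) (SUS ex mx) q),
      rootFrame (φL κ Φ t p O.D O.DT.toDataN O.ori (gOf κ Φ t p O gv) (fOf κ Φ t p O fv)) t 1 w ∈
        Finset.Icc (KS.B0 κ Φ t p O.merged mk (gOf κ Φ t p O gv) (fOf κ Φ t p O fv)).regionLo (KS.B0 κ Φ t p O.merged mk (gOf κ Φ t p O gv) (fOf κ Φ t p O fv)).regionHi →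
      RootFootT (fcellsT κ Φ t p O.merged (gOf κ Φ t p O gv) (fOf κ Φ t p O fv) (cOf κ Φ t p O gv fv cv)) (((0 : Fin 2), true) : MDir) ((fineOA κ Φ t p O.D O.DT.toDataN O.ori (gOf κ Φ t p O gv) (fOf κ Φ t p O fv)) w))
    (hfoot₂ : ∀ c₁ : V, (φL κ Φ t p O.D O.DT.toDataN O.ori (gOf κ Φ t p O gv) (fOf κ Φ t p O fv)) c₁ 0 - (φL κ Φ t p O.D O.DT.toDataN O.ori (gOf κ Φ t p O gv) (fOf κ Φ t p O fv)) t 0 =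
        KS.X1 κ Φ t p O.merged mk (gOf κ Φ t p O gv) (fOf κ Φ t p O fv) (kgq κ Φ t p O.merged (gOf κ Φ t p O gv) (fOf κ Φ t p O fv) qx) →
      (φL κ Φ t p O.D O.DT.toDataN O.ori (gOf κ Φ t p O gv) (fOf κ Φ t p O fv)) c₁ 1 - (φL κ Φ t p O.D O.DT.toDataN O.ori (gOf κ Φ t p O gv) (fOf κ Φ t p O fv)) t 1 =
        KS.Y1s κ Φ t p O.merged mk (gOf κ Φ t p O gv) (fOf κ Φ t p O fv) (kgq κ Φ t p O.merged (gOf κ Φ t p O gv) (fOf κ Φ t p O fv) qx) →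
      ∀ k ≤ (Skelφ.kgCorrSched ((kgRows0_of κ Φ t p O.merged (gOf κ Φ t p O gv) (fOf κ Φ t p O fv) mk qx Wx (eqNumL_of_atQ (atQ3_of_atQ3T hAt)) hgK).kgVals_ok₁ (KS.kgNR κ Φ t p O.merged mk (gOf κ Φ t p O gv) (fOf κ Φ t p O fv) qx Wx))
          ((kgRows0_of κ Φ t p O.merged (gOf κ Φ t p O gv) (fOf κ Φ t p O fv) mk qx Wx (eqNumL_of_atQ (atQ3_of_atQ3T hAt)) hgK).kgVals_ok₂ (KS.kgNR κ Φ t p O.merged mk (gOf κ Φ t p O gv) (fOf κ Φ t p O fv) qx Wx))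
          ((kgRows0_of κ Φ t p O.merged (gOf κ Φ t p O gv) (fOf κ Φ t p O fv) mk qx Wx (eqNumL_of_atQ (atQ3_of_atQ3T hAt)) hgK).kgVals_split (KS.kgNR κ Φ t p O.merged mk (gOf κ Φ t p O gv) (fOf κ Φ t p O fv) qx Wx))).N,
      ∀ w ∈ graphBall G t (Rπ κ Φ t p O.merged (gOf κ Φ t p O gv) (fOf κ Φ t p O fv) (SUS ex mx) q),
        Skelφ.runX (φL κ Φ t p O.D O.DT.toDataN O.ori (gOf κ Φ t p O gv) (fOf κ Φ t p O fv)) c₁ (nL κ Φ t p O.merged (gOf κ Φ t p O gv) (fOf κ Φ t p O fv)) (hL κ Φ t p O.merged (gOf κ Φ t p O gv) (fOf κ Φ t p O fv)) 1 w ∈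
          (Skelφ.kgCorrSched ((kgRows0_of κ Φ t p O.merged (gOf κ Φ t p O gv) (fOf κ Φ t p O fv) mk qx Wx (eqNumL_of_atQ (atQ3_of_atQ3T hAt)) hgK).kgVals_ok₁ (KS.kgNR κ Φ t p O.merged mk (gOf κ Φ t p O gv) (fOf κ Φ t p O fv) qx Wx))
            ((kgRows0_of κ Φ t p O.merged (gOf κ Φ t p O gv) (fOf κ Φ t p O fv) mk qx Wx (eqNumL_of_atQ (atQ3_of_atQ3T hAt)) hgK).kgVals_ok₂ (KS.kgNR κ Φ t p O.merged mk (gOf κ Φ t p O gv) (fOf κ Φ t p O fv) qx Wx))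
            ((kgRows0_of κ Φ t p O.merged (gOf κ Φ t p O gv) (fOf κ Φ t p O fv) mk qx Wx (eqNumL_of_atQ (atQ3_of_atQ3T hAt)) hgK).kgVals_split (KS.kgNR κ Φ t p O.merged mk (gOf κ Φ t p O gv) (fOf κ Φ t p O fv) qx Wx))).region k →
        RootFootT (fcellsT κ Φ t p O.merged (gOf κ Φ t p O gv) (fOf κ Φ t p O fv) (cOf κ Φ t p O gv fv cv)) (((0 : Fin 2), true) : MDir) ((fineOA κ Φ t p O.D O.DT.toDataN O.ori (gOf κ Φ t p O gv) (fOf κ Φ t p O fv)) w))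
    (hlastf : ∀ c₁ : V, (φL κ Φ t p O.D O.DT.toDataN O.ori (gOf κ Φ t p O gv) (fOf κ Φ t p O fv)) c₁ 0 - (φL κ Φ t p O.D O.DT.toDataN O.ori (gOf κ Φ t p O gv) (fOf κ Φ t p O fv)) t 0 =
        KS.X1 κ Φ t p O.merged mk (gOf κ Φ t p O gv) (fOf κ Φ t p O fv) (kgq κ Φ t p O.merged (gOf κ Φ t p O gv) (fOf κ Φ t p O fv) qx) →
      (φL κ Φ t p O.D O.DT.toDataN O.ori (gOf κ Φ t p O gv) (fOf κ Φ t p O fv)) c₁ 1 - (φL κ Φ t p O.D O.DT.toDataN O.ori (gOf κ Φ t p O gv) (fOf κ Φ t p O fv)) t 1 =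
        KS.Y1s κ Φ t p O.merged mk (gOf κ Φ t p O gv) (fOf κ Φ t p O fv) (kgq κ Φ t p O.merged (gOf κ Φ t p O gv) (fOf κ Φ t p O fv) qx) →
      ∀ w ∈ graphBall G t (Rπ κ Φ t p O.merged (gOf κ Φ t p O gv) (fOf κ Φ t p O fv) (SUS ex mx) q),
        Skelφ.runX (φL κ Φ t p O.D O.DT.toDataN O.ori (gOf κ Φ t p O gv) (fOf κ Φ t p O fv)) c₁ (nL κ Φ t p O.merged (gOf κ Φ t p O gv) (fOf κ Φ t p O fv)) (hL κ Φ t p O.merged (gOf κ Φ t p O gv) (fOf κ Φ t p O fv)) 1 w ∈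
          ScheduleNP.core (Skelφ.kgCorrSched ((kgRows0_of κ Φ t p O.merged (gOf κ Φ t p O gv) (fOf κ Φ t p O fv) mk qx Wx (eqNumL_of_atQ (atQ3_of_atQ3T hAt)) hgK).kgVals_ok₁ (KS.kgNR κ Φ t p O.merged mk (gOf κ Φ t p O gv) (fOf κ Φ t p O fv) qx Wx))
            ((kgRows0_of κ Φ t p O.merged (gOf κ Φ t p O gv) (fOf κ Φ t p O fv) mk qx Wx (eqNumL_of_atQ (atQ3_of_atQ3T hAt)) hgK).kgVals_ok₂ (KS.kgNR κ Φ t p O.merged mk (gOf κ Φ t p O gv) (fOf κ Φ t p O fv) qx Wx))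
            ((kgRows0_of κ Φ t p O.merged (gOf κ Φ t p O gv) (fOf κ Φ t p O fv) mk qx Wx (eqNumL_of_atQ (atQ3_of_atQ3T hAt)) hgK).kgVals_split (KS.kgNR κ Φ t p O.merged mk (gOf κ Φ t p O gv) (fOf κ Φ t p O fv) qx Wx)))
            ((Skelφ.kgCorrSched ((kgRows0_of κ Φ t p O.merged (gOf κ Φ t p O gv) (fOf κ Φ t p O fv) mk qx Wx (eqNumL_of_atQ (atQ3_of_atQ3T hAt)) hgK).kgVals_ok₁ (KS.kgNR κ Φ t p O.merged mk (gOf κ Φ t p O gv) (fOf κ Φ t p O fv) qx Wx))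
              ((kgRows0_of κ Φ t p O.merged (gOf κ Φ t p O gv) (fOf κ Φ t p O fv) mk qx Wx (eqNumL_of_atQ (atQ3_of_atQ3T hAt)) hgK).kgVals_ok₂ (KS.kgNR κ Φ t p O.merged mk (gOf κ Φ t p O gv) (fOf κ Φ t p O fv) qx Wx))
              ((kgRows0_of κ Φ t p O.merged (gOf κ Φ t p O gv) (fOf κ Φ t p O fv) mk qx Wx (eqNumL_of_atQ (atQ3_of_atQ3T hAt)) hgK).kgVals_split (KS.kgNR κ Φ t p O.merged mk (gOf κ Φ t p O gv) (fOf κ Φ t p O fv) qx Wx))).N + 1) →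
        TargetFootT (fcellsT κ Φ t p O.merged (gOf κ Φ t p O gv) (fOf κ Φ t p O fv) (cOf κ Φ t p O gv fv cv)) (bOf κ Φ t p O gv fv bv) (((0 : Fin 2), true) : MDir) ((fineOA κ Φ t p O.D O.DT.toDataN O.ori (gOf κ Φ t p O gv) (fOf κ Φ t p O fv)) w))
    (hDm : ∀ d ∈ ((((KSchA.mk (ΓQT κ Φ t p O gv fv (SUS ex mx) cv bv q) q κ.δ : KSchA V ℕ)).U0root (((0 : Fin 2), true) : MDir)).filter fun y => y ∈ graphBall G t (Rπ κ Φ t p O.merged (gOf κ Φ t p O gv) (fOf κ Φ t p O fv) (SUS ex mx) q)) \ O.merged.Λ t O.merged.k,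
      ∀ d' ∈ ((((KSchA.mk (ΓQT κ Φ t p O gv fv (SUS ex mx) cv bv q) q κ.δ : KSchA V ℕ)).U0root (((0 : Fin 2), true) : MDir)).filter fun y => y ∈ graphBall G t (Rπ κ Φ t p O.merged (gOf κ Φ t p O gv) (fOf κ Φ t p O fv) (SUS ex mx) q)) \ O.merged.Λ t O.merged.k,
        (φL κ Φ t p O.D O.DT.toDataN O.ori (gOf κ Φ t p O gv) (fOf κ Φ t p O fv)) d - (φL κ Φ t p O.D O.DT.toDataN O.ori (gOf κ Φ t p O gv) (fOf κ Φ t p O fv)) d' ∈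
          box 2 (mRS κ Φ t p O.merged (gOf κ Φ t p O gv) (fOf κ Φ t p O fv) (mx κ Φ t p O.merged (gOf κ Φ t p O gv) (fOf κ Φ t p O fv)))) :
    ∃ n, n ≤ LfQ κ.K₀ ∧ ∃ (c : V) (Rπ : ℕ) (W : Sym2 V → unitInterval) (s : Fin (n + 1) → KNLevels.TStep (winGraph G c Rπ))
      (T' : Fin (n + 1) → Finset V) (η' : ℝ),
      (∀ T : Finset V, (prodBernoulli W).real (⋃ t' ∈ T, openConn (ΓQT κ Φ t p O gv fv (SUS ex mx) cv bv q).root t') ≤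
        (prodBernoulli (pinW (KNLevels.lattW G q) ↑((⟨ΓQT κ Φ t p O gv fv (SUS ex mx) cv bv q, q, κ.δ⟩ : KSchA V ℕ).U₀ G)
          ↑((⟨ΓQT κ Φ t p O gv fv (SUS ex mx) cv bv q, q, κ.δ⟩ : KSchA V ℕ).U₀ G))).real
          (⋃ t' ∈ (↑T : Set V), openConnIn (↑((ΓQT κ Φ t p O gv fv (SUS ex mx) cv bv q).Q (ΓQT κ Φ t p O gv fv (SUS ex mx) cv bv q).a₀ 0 ∪
            (ΓQT κ Φ t p O gv fv (SUS ex mx) cv bv q).Ewv (ΓQT κ Φ t p O gv fv (SUS ex mx) cv bv q).a₀ 0 (((0 : Fin 2), true) : MDir)) : Set V)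
            (ΓQT κ Φ t p O gv fv (SUS ex mx) cv bv q).root t')) ∧
      (∀ i : Fin (n + 1), (s i).L.o = (ΓQT κ Φ t p O gv fv (SUS ex mx) cv bv q).root) ∧
      (∀ i : Fin n, T' (Fin.castSucc i) ⊆ (s i.succ).L.X 0) ∧ (∀ i : Fin (n + 1), T' i ⊆ (s i).T) ∧
      (∀ i : Fin (n + 1), (s i).KitsAtF W q Φ.Δ (κ.δr 0)) ∧ η' ≤ κ.δr 0 / 2 ∧
      (∀ i : Fin (n + 1), (prodBernoulli W).real (⋃ t' ∈ (s i).T \ T' i, openConn (ΓQT κ Φ t p O gv fv (SUS ex mx) cv bv q).root t') ≤ η') ∧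
      1 - κ.δr 0 < (prodBernoulli W).real (s 0).L.reachB ∧
      T' (Fin.last n) ⊆ (ΓQT κ Φ t p O gv fv (SUS ex mx) cv bv q).M (ΓQT κ Φ t p O gv fv (SUS ex mx) cv bv q).a₀ ((0 : Site 2) + stepVec (((0 : Fin 2), true) : MDir)) := by
  have hAt' := atQ3_of_atQ3T hAt
  -- facts at `AtQNQ`
  have hN : EqNumL κ Φ t p O.merged (gOf κ Φ t p O gv) (fOf κ Φ t p O fv) := eqNumL_of_atQ hAt'
  obtain ⟨hn1, -⟩ := one_le_of_eqNumL κ Φ t p O.merged (gOf κ Φ t p O gv) (fOf κ Φ t p O fv) hN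
  obtain ⟨-, -, -, hCq⟩ := factsNS_of_atQ hAt'
  have hδ0 : 0 < κ.δr 0 := (κ.hδr 0).1
  have hkit : Neg.δkit κ Φ ≤ κ.δr 0 := Neg.δkit_le_δr κ Φ (n := 0) (by norm_num)
  have hη : Neg.η κ Φ ≤ κ.δr 0 / 2 := by
    unfold Neg.η; exact div_le_div_of_nonneg_right hkit (by norm_num)
  have hstepφ := steps_φL κ Φ t p O.D O.DT.toDataN O.ori (gOf κ Φ t p O gv) (fOf κ Φ t p O fv)
  -- the RootRun floors at this window
  obtain ⟨-, -, hs958, -, -, -, -⟩ := KS.rootRun_floors κ Φ t p O.merged mk (gOf κ Φ t p O gv) (fOf κ Φ t p O fv) hN hgK hg2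
  obtain ⟨hnR, hrow⟩ := KS.hrowR κ Φ t p O.merged mk (gOf κ Φ t p O gv) (fOf κ Φ t p O fv) qx Wx hN hgK hg2 hqx hWx hf
  -- the landing vertex on the terminal's shear line ((R-47)(a))
  obtain ⟨c₁, hc₁, hX, hY⟩ := KS.exists_landing0s κ Φ t p O.merged mk (gOf κ Φ t p O gv) (fOf κ Φ t p O fv) (kgq κ Φ t p O.merged (gOf κ Φ t p O gv) (fOf κ Φ t p O fv) qx) hstepφ
  -- the bridge of record
  have hℓB27 := ℓB0_ge_of_atQ3 hAt' mk
  have hℓB3 : 3 ≤ KS.ℓB0 κ Φ t p O.merged mk := by omega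
  obtain ⟨hQb, hFb, -⟩ := bridge0Sets_of_atQ3 hAt' mk
  have hbridge := hbridge0K_of_atQ3_δr hAt' h1 mk hPx
  -- the ex-floors read into the window radius `Rπ`
  have hr₀R := ex_le_Rπ κ Φ t p O.merged (gOf κ Φ t p O gv) (fOf κ Φ t p O fv) ex mx q hexRL
  have hr₀bR := ex_le_Rπ κ Φ t p O.merged (gOf κ Φ t p O gv) (fOf κ Φ t p O fv) ex mx q hexRB
  have hYbπ := ex_le_Rπ κ Φ t p O.merged (gOf κ Φ t p O gv) (fOf κ Φ t p O fv) ex mx q hexYb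
  have hZπ := ex_le_Rπ κ Φ t p O.merged (gOf κ Φ t p O gv) (fOf κ Φ t p O fv) ex mx q hexZ
  have hc1R : ((KS.B0 κ Φ t p O.merged mk (gOf κ Φ t p O gv) (fOf κ Φ t p O fv)).core1Lo 0).natAbs +
      ((KS.B0 κ Φ t p O.merged mk (gOf κ Φ t p O gv) (fOf κ Φ t p O fv)).core1Lo 1).natAbs ≤ Rπ κ Φ t p O.merged (gOf κ Φ t p O gv) (fOf κ Φ t p O fv) (SUS ex mx) q :=
    (KS.core1Lo_0_l1 κ Φ t p O.merged mk (gOf κ Φ t p O gv) (fOf κ Φ t p O fv)).trans hYbπ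
  -- the cross-link budget `prB0 + ℓB0 + 5R'0 + 2 ≤ W` ((R-47)(b): `sL ≥ M_L − 1 ≥ g − 1 ≥ 2f + 5R'0 + 2`)
  have hprB := KS.le_prB0 κ Φ t p O.merged mk
  have hfx : KS.Rs t O.merged mk + KS0.R'0 κ Φ t p O.merged mk + KS.prB0 κ Φ t p O.merged mk + 1 ≤ fOf κ Φ t p O fv := by
    have h := hf; rw [KS.fxR0_eq] at h; exact h
  have hML := (ML_le_ML κ Φ t p O.merged (gOf κ Φ t p O gv)).2
  have hsL := ML_sub_one_le_kgSL κ Φ t p O.merged (gOf κ Φ t p O gv) (fOf κ Φ t p O fv) hN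
  have hsL0 : (0 : ℤ) ≤ kgSL (nL κ Φ t p O.merged (gOf κ Φ t p O gv) (fOf κ Φ t p O fv)) (ℓL κ Φ t p O.merged (gOf κ Φ t p O gv) (fOf κ Φ t p O fv)) (hL κ Φ t p O.merged (gOf κ Φ t p O gv) (fOf κ Φ t p O fv)) := by
    linarith
  have hW : ((KS.prB0 κ Φ t p O.merged mk : ℕ) : ℤ) + (KS.ℓB0 κ Φ t p O.merged mk) + 5 * (KS0.R'0 κ Φ t p O.merged mk : ℤ) + 2 ≤
      (kgW κ Φ t p O.merged (gOf κ Φ t p O gv) (fOf κ Φ t p O fv) Wx : ℕ) := by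
    have hWx0 : (0 : ℤ) ≤ (Wx : ℤ) := by positivity
    have h1 : ((ML κ Φ t p O.merged (gOf κ Φ t p O gv) : ℕ) : ℤ) - 1 ≤ (kgW κ Φ t p O.merged (gOf κ Φ t p O gv) (fOf κ Φ t p O fv) Wx : ℕ) := by
      unfold kgW; push_cast; rw [Int.toNat_of_nonneg hsL0]; linarith
    have h2 : ((gOf κ Φ t p O gv : ℕ) : ℤ) ≤ ((ML κ Φ t p O.merged (gOf κ Φ t p O gv) : ℕ) : ℤ) := by exact_mod_cast hML
    have h3 : 2 * ((fOf κ Φ t p O fv : ℕ) : ℤ) + 5 * (KS0.R'0 κ Φ t p O.merged mk : ℤ) + 3 ≤ ((gOf κ Φ t p O gv : ℕ) : ℤ) := by exact_mod_cast hfg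
    have h4n : KS.prB0 κ Φ t p O.merged mk + 1 ≤ fOf κ Φ t p O fv := by have := hfx; omega
    have h4 : ((KS.prB0 κ Φ t p O.merged mk : ℕ) : ℤ) + 1 ≤ ((fOf κ Φ t p O fv : ℕ) : ℤ) := by exact_mod_cast h4n
    have h5n : 3 * KS.ℓB0 κ Φ t p O.merged mk ≤ KS.prB0 κ Φ t p O.merged mk := by have := hprB.2; omega
    have h5 : 3 * ((KS.ℓB0 κ Φ t p O.merged mk : ℕ) : ℤ) ≤ ((KS.prB0 κ Φ t p O.merged mk : ℕ) : ℤ) := by exact_mod_cast h5n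
    linarith
  have hRq : KS0.R'0 κ Φ t p O.merged mk ≤ kgq κ Φ t p O.merged (gOf κ Φ t p O gv) (fOf κ Φ t p O fv) qx := by
    unfold kgq; omega
  -- the depth row: `D0s + 13·(reach at N_R) ≤ D0s + Z + 13·sL ≤ Rπ`
  have hreach := KS.reachR1_le κ Φ t p O.merged mk (gOf κ Φ t p O gv) (fOf κ Φ t p O fv) qx Wx hN hgK hg2 hqx hWx hf (Z : ℤ) hZ
  have hRD : ((KS.D0s κ Φ t p O.merged mk (gOf κ Φ t p O gv) (fOf κ Φ t p O fv) (kgq κ Φ t p O.merged (gOf κ Φ t p O gv) (fOf κ Φ t p O fv) qx) : ℕ) : ℤ) +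
      (10 + 3) * ((((KS.kgNR κ Φ t p O.merged mk (gOf κ Φ t p O gv) (fOf κ Φ t p O fv) qx Wx : ℕ) : ℤ) + 1) * (nL κ Φ t p O.merged (gOf κ Φ t p O gv) (fOf κ Φ t p O fv) : ℤ) +
        kgZ₀ (nL κ Φ t p O.merged (gOf κ Φ t p O gv) (fOf κ Φ t p O fv)) (vL κ Φ t p O.merged (gOf κ Φ t p O gv) (fOf κ Φ t p O fv)) (KS0.R'0 κ Φ t p O.merged mk) 0 (kgq κ Φ t p O.merged (gOf κ Φ t p O gv) (fOf κ Φ t p O fv) qx)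
          (KS.kgNR κ Φ t p O.merged mk (gOf κ Φ t p O gv) (fOf κ Φ t p O fv) qx Wx)
          (kgM₁ (nL κ Φ t p O.merged (gOf κ Φ t p O gv) (fOf κ Φ t p O fv)) (ℓL κ Φ t p O.merged (gOf κ Φ t p O gv) (fOf κ Φ t p O fv)) (hL κ Φ t p O.merged (gOf κ Φ t p O gv) (fOf κ Φ t p O fv)) (KS0.R'0 κ Φ t p O.merged mk) 0 (kgW κ Φ t p O.merged (gOf κ Φ t p O gv) (fOf κ Φ t p O fv) Wx)
            (KS.kgNR κ Φ t p O.merged mk (gOf κ Φ t p O gv) (fOf κ Φ t p O fv) qx Wx))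
          (kgM₂ (nL κ Φ t p O.merged (gOf κ Φ t p O gv) (fOf κ Φ t p O fv)) (ℓL κ Φ t p O.merged (gOf κ Φ t p O gv) (fOf κ Φ t p O fv)) (hL κ Φ t p O.merged (gOf κ Φ t p O gv) (fOf κ Φ t p O fv)) (vL κ Φ t p O.merged (gOf κ Φ t p O gv) (fOf κ Φ t p O fv)) (KS0.R'0 κ Φ t p O.merged mk) 0
            (kgq κ Φ t p O.merged (gOf κ Φ t p O gv) (fOf κ Φ t p O fv) qx) (kgW κ Φ t p O.merged (gOf κ Φ t p O gv) (fOf κ Φ t p O fv) Wx) (KS.kgNR κ Φ t p O.merged mk (gOf κ Φ t p O gv) (fOf κ Φ t p O fv) qx Wx)) +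
        kgZ₁ (nL κ Φ t p O.merged (gOf κ Φ t p O gv) (fOf κ Φ t p O fv)) (ℓL κ Φ t p O.merged (gOf κ Φ t p O gv) (fOf κ Φ t p O fv)) (hL κ Φ t p O.merged (gOf κ Φ t p O gv) (fOf κ Φ t p O fv)) (KS0.R'0 κ Φ t p O.merged mk) 0 (kgW κ Φ t p O.merged (gOf κ Φ t p O gv) (fOf κ Φ t p O fv) Wx)
          (KS.kgNR κ Φ t p O.merged mk (gOf κ Φ t p O gv) (fOf κ Φ t p O fv) qx Wx)
          (kgM₁ (nL κ Φ t p O.merged (gOf κ Φ t p O gv) (fOf κ Φ t p O fv)) (ℓL κ Φ t p O.merged (gOf κ Φ t p O gv) (fOf κ Φ t p O fv)) (hL κ Φ t p O.merged (gOf κ Φ t p O gv) (fOf κ Φ t p O fv)) (KS0.R'0 κ Φ t p O.merged mk) 0 (kgW κ Φ t p O.merged (gOf κ Φ t p O gv) (fOf κ Φ t p O fv) Wx)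
            (KS.kgNR κ Φ t p O.merged mk (gOf κ Φ t p O gv) (fOf κ Φ t p O fv) qx Wx))
          (kgWm₂ (nL κ Φ t p O.merged (gOf κ Φ t p O gv) (fOf κ Φ t p O fv)) (ℓL κ Φ t p O.merged (gOf κ Φ t p O gv) (fOf κ Φ t p O fv)) (hL κ Φ t p O.merged (gOf κ Φ t p O gv) (fOf κ Φ t p O fv)) (KS0.R'0 κ Φ t p O.merged mk) 0 (kgW κ Φ t p O.merged (gOf κ Φ t p O gv) (fOf κ Φ t p O fv) Wx)
            (KS.kgNR κ Φ t p O.merged mk (gOf κ Φ t p O gv) (fOf κ Φ t p O fv) qx Wx))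
          (kgWp₂ (nL κ Φ t p O.merged (gOf κ Φ t p O gv) (fOf κ Φ t p O fv)) (ℓL κ Φ t p O.merged (gOf κ Φ t p O gv) (fOf κ Φ t p O fv)) (hL κ Φ t p O.merged (gOf κ Φ t p O gv) (fOf κ Φ t p O fv)) (KS0.R'0 κ Φ t p O.merged mk) 0 (kgW κ Φ t p O.merged (gOf κ Φ t p O gv) (fOf κ Φ t p O fv) Wx)
            (KS.kgNR κ Φ t p O.merged mk (gOf κ Φ t p O gv) (fOf κ Φ t p O fv) qx Wx))
          (kgM₂ (nL κ Φ t p O.merged (gOf κ Φ t p O gv) (fOf κ Φ t p O fv)) (ℓL κ Φ t p O.merged (gOf κ Φ t p O gv) (fOf κ Φ t p O fv)) (hL κ Φ t p O.merged (gOf κ Φ t p O gv) (fOf κ Φ t p O fv)) (vL κ Φ t p O.merged (gOf κ Φ t p O gv) (fOf κ Φ t p O fv)) (KS0.R'0 κ Φ t p O.merged mk) 0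
            (kgq κ Φ t p O.merged (gOf κ Φ t p O gv) (fOf κ Φ t p O fv) qx) (kgW κ Φ t p O.merged (gOf κ Φ t p O gv) (fOf κ Φ t p O fv) Wx) (KS.kgNR κ Φ t p O.merged mk (gOf κ Φ t p O gv) (fOf κ Φ t p O fv) qx Wx))) ≤
      Rπ κ Φ t p O.merged (gOf κ Φ t p O gv) (fOf κ Φ t p O fv) (SUS ex mx) q := by
    have h1 : ((KS.D0s κ Φ t p O.merged mk (gOf κ Φ t p O gv) (fOf κ Φ t p O fv) (kgq κ Φ t p O.merged (gOf κ Φ t p O gv) (fOf κ Φ t p O fv) qx) : ℕ) : ℤ) + (Z : ℤ) +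
        13 * kgSL (nL κ Φ t p O.merged (gOf κ Φ t p O gv) (fOf κ Φ t p O fv)) (ℓL κ Φ t p O.merged (gOf κ Φ t p O gv) (fOf κ Φ t p O fv)) (hL κ Φ t p O.merged (gOf κ Φ t p O gv) (fOf κ Φ t p O fv)) ≤
        Rπ κ Φ t p O.merged (gOf κ Φ t p O gv) (fOf κ Φ t p O fv) (SUS ex mx) q := by
      have h := hZπ; zify at h; rw [Int.toNat_of_nonneg hsL0] at h; linarith
    have e : ((10 : ℤ) + 3) = 13 := by norm_num
    rw [e]
    unfold kgR at hreach
    linarith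
  -- assemble: the skeleton at the values of record
  have HK := kgRows0_of κ Φ t p O.merged (gOf κ Φ t p O gv) (fOf κ Φ t p O fv) mk qx Wx (eqNumL_of_atQ (atQ3_of_atQ3T hAt)) hgK
  have hmain := rootLegAt_frmQ3KT_fst LfQ hAt h1 hp0 hp1 mk HK
    (KS.kgNR κ Φ t p O.merged mk (gOf κ Φ t p O gv) (fOf κ Φ t p O fv) qx Wx)
    (Rb := KS.RB0 κ Φ t p O.merged mk) hr₀R hr₀bR
    (hRQ_RT κ Φ t p O.merged (gOf κ Φ t p O gv) (fOf κ Φ t p O fv) (cOf κ Φ t p O gv fv cv) (SUS ex mx) q)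
    (hRB_RT κ Φ t p O.merged (gOf κ Φ t p O gv) (fOf κ Φ t p O fv) (cOf κ Φ t p O gv fv cv) (SUS ex mx) q _)
    (hRQ'_RT κ Φ t p O.merged (gOf κ Φ t p O gv) (fOf κ Φ t p O fv) (cOf κ Φ t p O gv fv cv) (SUS ex mx) q _)
    (hRM_RT κ Φ t p O.merged (gOf κ Φ t p O gv) (fOf κ Φ t p O fv) (cOf κ Φ t p O gv fv cv) (SUS ex mx) q _)
    (fat_le_Rπ κ Φ t p O.merged (gOf κ Φ t p O gv) (fOf κ Φ t p O fv) ex mx q hC)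
    (fun i => by rw [fcellsT_r]; exact hRs5 i)
    (hkR_hop_prism κ Φ t p O.merged (gOf κ Φ t p O gv) (fOf κ Φ t p O fv) hN)
    (by
      have h := hfR_hop_fst κ Φ t p O.merged (gOf κ Φ t p O gv) (fOf κ Φ t p O fv) hN
        (c₀ := (fcellsT κ Φ t p O.merged (gOf κ Φ t p O gv) (fOf κ Φ t p O fv) (cOf κ Φ t p O gv fv cv)).c 0)
        (fcellsT_c_le_r_oth κ Φ t p O.merged (gOf κ Φ t p O gv) (fOf κ Φ t p O fv) (cOf κ Φ t p O gv fv cv) 0)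
      simpa only [fcellsT_r] using h)
    c₁ hc₁ hRD
    (KS.B0 κ Φ t p O.merged mk (gOf κ Φ t p O gv) (fOf κ Φ t p O fv)) (B0_ok_of_atQ3 hAt' mk)
    (KS.B0_lo_le_hi κ Φ t p O.merged mk (gOf κ Φ t p O gv) (fOf κ Φ t p O fv))
    (KS.R'0_le_B0_R' κ Φ t p O.merged mk (gOf κ Φ t p O gv) (fOf κ Φ t p O fv))
    (KS.B0_core1_le κ Φ t p O.merged mk (gOf κ Φ t p O gv) (fOf κ Φ t p O fv) hℓB3) hc1R
    (KS.hhopB_0 κ Φ t p O.merged mk (gOf κ Φ t p O gv) (fOf κ Φ t p O fv) _ _ hn1)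
    (KS.hclear₁_0_of_floor κ Φ t p O.merged mk (gOf κ Φ t p O gv) (fOf κ Φ t p O fv) hf)
    _ _ hQb hFb hbridge
    hfoot₁ (hfoot₂ c₁ hX hY) (hlastf c₁ hX hY) hnR hrow
    (by rw [hX]; exact KS.hX₁_0 κ Φ t p O.merged mk (gOf κ Φ t p O gv) (fOf κ Φ t p O fv) _)
    (fun w _ hw => KS.hx_0s κ Φ t p O.merged mk (gOf κ Φ t p O gv) (fOf κ Φ t p O fv) _ hN HK (KS.kgNR κ Φ t p O.merged mk (gOf κ Φ t p O gv) (fOf κ Φ t p O fv) qx Wx) hW hRq hX hY hw)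
    hDm
    (hR₁_US κ Φ t p O.merged (gOf κ Φ t p O gv) (fOf κ Φ t p O fv) ex mx q hCq (oL κ Φ t p O.D O.DT.toDataN O.ori (gOf κ Φ t p O gv) (fOf κ Φ t p O fv)) hη t
      (Skelφ.fatRadius Φ.frame hC O.merged.k))
    (SRex_fat_le_Rπ_sub κ Φ t p O.merged (gOf κ Φ t p O gv) (fOf κ Φ t p O fv) ex mx q hC hexRB)
    (SRex_fat_le_Rπ_sub κ Φ t p O.merged (gOf κ Φ t p O gv) (fOf κ Φ t p O fv) ex mx q hC hexRL)
    (by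
      rw [ChainPlanar.BridgePrm.bridgeFrame_N]
      exact KS.hlen_R1 κ Φ t p O.merged mk (gOf κ Φ t p O gv) (fOf κ Φ t p O fv) qx Wx hN hgK hg2 hqx hWx hf hx3)
  exact hmain

end NegB

end PlanarSkeletonFrm

end Transplant

end Summit.CriticalPhenomena.PercolationContinuityZ3.Theorems

end
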